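import Summits.HubbardSuperconductivity.HubbardSuperconductivity.Theorems.AnisotropyChordTransferFibre3RowCExpr
import Literature.Analysis.Fourier.FejerHarmonicSum

/-!
# Route `AnisotropyChord` / H0 rotor rung, row D (KT-2a) Stage-1 evaluator: `θ`-SCALED COMPLEX PAIRS over `RExpr`

The closed atoms of the row-D coefficients `R̂′(k)` (g27's `closedPartU`, `MFormTransform`, `BoundaryLines`; p1 g29 memo
ROWD-DESIGN-g29 §5) are complex: products of real cell quantities with phases `e^{∓iθm}` and gradient weights `1 − e^{−iθm}`
(`θ = 2π/L`, `m` a small integer).  For an `L`-UNIFORM (`∀ L ≥ 128`) kernel evaluation every `O(θ)` quantity must be carried as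
`θ ×` (bounded atom): this file represents a complex number `x + i·θ·y` by the PAIR `(x, y)` of real `RExpr` terms — the
imaginary part pre-divided by `θ` — with the algebra
  `(x₁, y₁)·(x₂, y₂) = (x₁x₂ − t·y₁y₂, x₁y₂ + y₁x₂)`,  `t = θ² = y₀` (p2's cell coordinate 0),
so that products stay polynomial in `t` (no `√t`), and the real part of any product of atoms — the only part a REAL coefficient
`R̂′(k)` needs — is an `RExpr` in `t`.  Atoms: real scalars `(e, 0)`; the phase `e^{−iθm} = (1 − t·ŵ, −m·ŝ)` and the gradient
weight `1 − e^{−iθm} = (t·ŵ, m·ŝ)` from the normalised trig atoms `ŵ = (1 − cos mθ)/θ²` (p2's `wSpec` coordinates) and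
`ŝ = sin(mθ)/(mθ)` (sinc; bracket `ŝ ∈ [1 − m²t/6, 1]`, `sinc_bracket`).
★ `peval_padd/psub/pneg/pscale/pmul/psum`, `peval_pphase`, `peval_pweight` (exact evaluation lemmas), `sinc_bracket`.
Prover seat `hubbard-h0-rotor-p1` g29 (route lead); helper for piece A = stmt-HubbardSuperconductivity-23918 of rung 19089
(`--supports`, helper class).  Nothing here proves superconductivity in the Hubbard model; computable definitions + eval lemmas for
ONE row of ONE conditional reduction; the rotor TARGET as originally worded stays FALSE (g15 verdict).  Tree imports only; no sorry.
-/

set_option linter.dupNamespace false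
set_option autoImplicit false

open Literature.Analysis.ValidatedNumerics

namespace Summit.HubbardSuperconductivity.HubbardSuperconductivity.Theorems.AnisotropyChord.Transfer.Fibre3

namespace RowD

open RowC L2.N1

/-! ## The pair algebra -/

/-- the complex number denoted by a `θ`-scaled pair: `x + i·θ·y`. -/
noncomputable def peval (θ : ℝ) (v : ℕ → ℝ) (p : RExpr × RExpr) : ℂ :=
  ((p.1.eval v : ℝ) : ℂ) + Complex.I * (θ : ℂ) * ((p.2.eval v : ℝ) : ℂ)

/-- a real scalar as a pair. -/
def preal (e : RExpr) : RExpr × RExpr := (e, cst 0)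

/-- sum. -/
def padd (p q : RExpr × RExpr) : RExpr × RExpr := (.add p.1 q.1, .add p.2 q.2)

/-- difference. -/
def psub (p q : RExpr × RExpr) : RExpr × RExpr := (.sub p.1 q.1, .sub p.2 q.2)

/-- negation. -/
def pneg (p : RExpr × RExpr) : RExpr × RExpr := (.neg p.1, .neg p.2)

/-- real scaling. -/
def pscale (e : RExpr) (p : RExpr × RExpr) : RExpr × RExpr := (.mul e p.1, .mul e p.2)

/-- product: `(x₁ + iθy₁)(x₂ + iθy₂) = (x₁x₂ − t y₁y₂) + iθ(x₁y₂ + y₁x₂)`, `t = y₀ = θ²`. -/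
def pmul (p q : RExpr × RExpr) : RExpr × RExpr :=
  (.sub (.mul p.1 q.1) (.mul (.mul yT p.2) q.2), .add (.mul p.1 q.2) (.mul p.2 q.1))

/-- complex conjugate. -/
def pconj (p : RExpr × RExpr) : RExpr × RExpr := (p.1, .neg p.2)

/-- sum of a list of pairs. -/
def psum : List (RExpr × RExpr) → RExpr × RExpr
  | [] => (cst 0, cst 0)
  | p :: ps => padd p (psum ps)

/-- the phase atom `e^{−iθm}` from the normalised trig atoms `ŵ = (1 − cos mθ)/θ²`, `ŝ = sin(mθ)/(mθ)`: `(1 − t·ŵ, −m·ŝ)`. -/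
def pphase (w s : RExpr) (m : ℤ) : RExpr × RExpr := (.sub (cst 1) (.mul yT w), .neg (.mul (cst (m : ℚ)) s))

/-- the gradient-weight atom `1 − e^{−iθm} = (t·ŵ, m·ŝ)`. -/
def pweight (w s : RExpr) (m : ℤ) : RExpr × RExpr := (.mul yT w, .mul (cst (m : ℚ)) s)

/-! ## Evaluation lemmas -/

section eval
variable (θ : ℝ) (v : ℕ → ℝ) (ht : v 0 = θ ^ 2)

/-- `preal e` evaluates to `e`. -/
theorem peval_preal (e : RExpr) : peval θ v (preal e) = ((e.eval v : ℝ) : ℂ) := by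
  simp [peval, preal, cst, RExpr.eval]

/-- `padd`. -/
theorem peval_padd (p q : RExpr × RExpr) : peval θ v (padd p q) = peval θ v p + peval θ v q := by
  simp only [peval, padd, RExpr.eval]; push_cast; ring

/-- `psub`. -/
theorem peval_psub (p q : RExpr × RExpr) : peval θ v (psub p q) = peval θ v p - peval θ v q := by
  simp only [peval, psub, RExpr.eval]; push_cast; ring

/-- `pneg`. -/
theorem peval_pneg (p : RExpr × RExpr) : peval θ v (pneg p) = -peval θ v p := by
  simp only [peval, pneg, RExpr.eval]; push_cast; ring

/-- `pscale`. -/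
theorem peval_pscale (e : RExpr) (p : RExpr × RExpr) :
    peval θ v (pscale e p) = ((e.eval v : ℝ) : ℂ) * peval θ v p := by
  simp only [peval, pscale, RExpr.eval]; push_cast; ring

/-- `pconj`. -/
theorem peval_pconj (p : RExpr × RExpr) : peval θ v (pconj p) = (starRingEnd ℂ) (peval θ v p) := by
  simp only [peval, pconj, RExpr.eval, map_add, map_mul, Complex.conj_ofReal, Complex.conj_I]
  push_cast; ring

include ht in
/-- `pmul` (uses `v 0 = θ²`). -/
theorem peval_pmul (p q : RExpr × RExpr) : peval θ v (pmul p q) = peval θ v p * peval θ v q := by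
  simp only [peval, pmul, yT, RExpr.eval, ht]
  push_cast
  have hI : Complex.I * Complex.I = -1 := Complex.I_mul_I
  ring_nf
  rw [pow_two Complex.I, hI]
  ring

/-- `psum`. -/
theorem peval_psum (ps : List (RExpr × RExpr)) : peval θ v (psum ps) = (ps.map (peval θ v)).sum := by
  induction ps with
  | nil => simp [psum, peval, cst, RExpr.eval]
  | cons p ps ih => rw [psum, peval_padd, ih, List.map_cons, List.sum_cons]

include ht in
/-- the phase atom: if `ŵ = (1 − cos mθ)/θ²` and `m·ŝ = sin(mθ)/θ` then `pphase ŵ ŝ m = e^{−iθm}`. -/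
theorem peval_pphase (hθ : θ ≠ 0) (w s : RExpr) (m : ℤ)
    (hw : w.eval v = (1 - Real.cos (m * θ)) / θ ^ 2) (hs : (m : ℝ) * s.eval v = Real.sin (m * θ) / θ) :
    peval θ v (pphase w s m) = Complex.exp (-(Complex.I * (θ : ℂ) * (m : ℂ))) := by
  have hθ2 : θ ^ 2 ≠ 0 := pow_ne_zero 2 hθ
  have e1 : (pphase w s m).1.eval v = Real.cos (m * θ) := by
    simp only [pphase, yT, cst, RExpr.eval, ht, hw]; push_cast; field_simp; ring
  have e2 : θ * (pphase w s m).2.eval v = -Real.sin (m * θ) := by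
    simp only [pphase, cst, RExpr.eval]
    push_cast
    have : θ * ((m : ℝ) * s.eval v) = Real.sin (m * θ) := by rw [hs]; field_simp
    linear_combination -this
  unfold peval
  rw [e1]
  have : Complex.I * (θ : ℂ) * (((pphase w s m).2.eval v : ℝ) : ℂ) = Complex.I * ((-Real.sin (m * θ) : ℝ) : ℂ) := by
    rw [← e2]; push_cast; ring
  rw [this]
  have harg : -(Complex.I * (θ : ℂ) * (m : ℂ)) = ((-(m * θ) : ℝ) : ℂ) * Complex.I := by push_cast; ring
  rw [harg, Complex.exp_mul_I, ← Complex.ofReal_cos, ← Complex.ofReal_sin, Real.cos_neg, Real.sin_neg]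
  push_cast; ring

include ht in
/-- the gradient-weight atom: `pweight ŵ ŝ m = 1 − e^{−iθm}`. -/
theorem peval_pweight (hθ : θ ≠ 0) (w s : RExpr) (m : ℤ)
    (hw : w.eval v = (1 - Real.cos (m * θ)) / θ ^ 2) (hs : (m : ℝ) * s.eval v = Real.sin (m * θ) / θ) :
    peval θ v (pweight w s m) = 1 - Complex.exp (-(Complex.I * (θ : ℂ) * (m : ℂ))) := by
  rw [← peval_pphase θ v ht hθ w s m hw hs]
  simp only [peval, pweight, pphase, yT, cst, RExpr.eval]
  push_cast; ring

end eval

/-! ## The sinc bracket -/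

/-- `sin x / x ∈ [1 − x²/6, 1]` for `x > 0`. [folklore] -/
theorem sinc_bracket {x : ℝ} (hx : 0 < x) : 1 - x ^ 2 / 6 ≤ Real.sin x / x ∧ Real.sin x / x ≤ 1 := by
  constructor
  · rw [le_div_iff₀ hx]
    have h := Literature.Analysis.Fourier.sub_cube_div_six_le_sin hx.le
    nlinarith [h]
  · rw [div_le_one hx]; exact Real.sin_le hx.le

/-- the normalised sine atom of order `m ≥ 1`: with `ŝ := sin(mθ)/(mθ)`, `m·ŝ = sin(mθ)/θ` and `ŝ ∈ [1 − m²t/6, 1]` (`t = θ²`, `θ > 0`). [folklore] -/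
theorem sinc_atom {θ : ℝ} (hθ : 0 < θ) (m : ℕ) (hm : 1 ≤ m) :
    (m : ℝ) * (Real.sin (m * θ) / (m * θ)) = Real.sin (m * θ) / θ ∧
    1 - (m : ℝ) ^ 2 * θ ^ 2 / 6 ≤ Real.sin (m * θ) / (m * θ) ∧ Real.sin (m * θ) / (m * θ) ≤ 1 := by
  have hm0 : (0 : ℝ) < m := by exact_mod_cast hm
  have hx : 0 < (m : ℝ) * θ := mul_pos hm0 hθ
  obtain ⟨h1, h2⟩ := sinc_bracket hx
  refine ⟨by field_simp, ?_, h2⟩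
  calc 1 - (m : ℝ) ^ 2 * θ ^ 2 / 6 = 1 - ((m : ℝ) * θ) ^ 2 / 6 := by ring
    _ ≤ _ := h1

end RowD

end Summit.HubbardSuperconductivity.HubbardSuperconductivity.Theorems.AnisotropyChord.Transfer.Fibre3
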